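import Mathlib
import Summits.ValiantsHypothesis.ValiantsHypothesis.Theorems.NewtonUnitEquationsTwoProductsPlanarCellTwo
import HarnessLib

/-!
# Crux `TwoProducts` (stmt-ValiantsHypothesis-5906), planar cells at `m = 2`: the coincidence-free case is `t`-FREE (rank 4)

Calibration (val-lit-p3 g13, NOTE §13.4 (b); desk GO RULING #157 (b)).  For two tails against two tails whose tail support `E`
has NO additive coincidences — `E ∩ (E + E) = ∅` and unique representation in `E + E` — every weight-order cell carries at
most `5` visible points (`planarCell_two_coincidenceFree`), independently of the sparsity `t`.  With
`planarCell_two_linear` (≤ `#E/2 + 2`, p601372) and the staircase family of `Negative/PlanarSlotBoundFalse.lean` (one cell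
with `K + 1 ≈ √(2t)` visible points, bought with `K(K+1)/2` coincidences `E ∩ (E + E)`), this locates ALL `t`-dependence of
the `m = 2` per-cell count in the additive coincidences of the tail support.

Proof (RANK 4).  Off `E`, the coefficient of `W = (1+u₀)(1+u₁) − (1+v₀)(1+v₁)` at `a + b` (`a, b ∈ E`) is, by unique
representation, the MAIN TERM `q(a,b) + q(b,a) = ⟨φ a, ψ b⟩` (halved when `a = b`), `q(a,b) = u₀[a]u₁[b] − v₀[a]v₁[b]`,
`φ a, ψ b ∈ ℂ⁴`.  Visible points outside `E` are `l = g_l + g'_l`; by the crossing lemma `nested_of_visible` (p601372) the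
keys `wt ζ g_l` are pairwise distinct and, for `l` outer to `l'`, the point `g_l + g'_{l'}` outweighs `l'` for every cell
weight, so `⟨φ g_l, ψ g'_{l'}⟩ = 0`, while `⟨φ g_l, ψ g'_l⟩ ≠ 0`: a triangular pairing, hence the `φ g_l` are linearly
independent in `ℂ⁴` (`linearIndependent_of_triangular`) and there are at most `4` of them; plus at most one visible point in
`E` (`PlanarCell.eq_of_visible_mem_tailSupport`).

Honest framing: a `t`-free statement in a special regime at fixed `m = 2`; `PlanarCross`, `PlanarCellBound`, the engine and
the crux `TwoProducts` are OPEN; `VP ≠ VNP` is NOT proved.  No named facts. [folklore]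
-/

noncomputable section

-- Sub = Summit single-conjunct layout: the duplicated namespace component is mandated by the tree.
set_option linter.dupNamespace false

open scoped BigOperators Pointwise
open MvPolynomial
open Summit.ValiantsHypothesis.ValiantsHypothesis.Theorems.NewtonUnitEquations.TwoProducts.FormalLogLinearisation

namespace Summit.ValiantsHypothesis.ValiantsHypothesis.Theorems.NewtonUnitEquations.TwoProducts.PlanarCell

/-- **Triangular pairing ⇒ linear independence.**  If `⟨φ x, ψ y⟩ = 0` whenever `key y < key x`, `⟨φ x, ψ x⟩ ≠ 0`, and the
keys are distinct, then the `φ x` are linearly independent. [folklore] -/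
theorem linearIndependent_of_triangular {ι : Type*} [Fintype ι] {n : ℕ} (key : ι → ℝ) (hkey : Function.Injective key)
    (φ ψ : ι → (Fin n → ℂ)) (h0 : ∀ x y, key y < key x → φ x ⬝ᵥ ψ y = 0) (h1 : ∀ x, φ x ⬝ᵥ ψ x ≠ 0) :
    LinearIndependent ℂ φ := by
  classical
  rw [Fintype.linearIndependent_iff]
  intro c hc
  by_contra hne
  obtain ⟨x₀, hx₀⟩ := not_forall.1 hne
  -- the index with nonzero coefficient and minimal key
  obtain ⟨xm, hxm, hmin⟩ := Finset.exists_min_image (Finset.univ.filter fun x => c x ≠ 0) key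
    ⟨x₀, Finset.mem_filter.2 ⟨Finset.mem_univ _, hx₀⟩⟩
  have hcm : c xm ≠ 0 := (Finset.mem_filter.1 hxm).2
  have hsum : (∑ x, c x • φ x) ⬝ᵥ ψ xm = 0 := by rw [hc]; exact zero_dotProduct _
  rw [sum_dotProduct] at hsum
  rw [Finset.sum_eq_single xm] at hsum
  · rw [smul_dotProduct, smul_eq_mul] at hsum
    exact (mul_ne_zero hcm (h1 xm)) hsum
  · intro x _ hx
    by_cases hcx : c x = 0
    · simp [hcx]
    · have hle : key xm ≤ key x := hmin x (Finset.mem_filter.2 ⟨Finset.mem_univ _, hcx⟩)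
      have hlt : key xm < key x := lt_of_le_of_ne hle fun h => hx (hkey h).symm
      rw [smul_dotProduct, h0 x xm hlt, smul_zero]
  · intro h; exact absurd (Finset.mem_univ xm) h

variable (u v : Fin 2 → MvPolynomial (Fin 2) ℂ)

/-- The main-term vectors `φ a = (u₀[a], u₁[a], v₀[a], v₁[a])`. [folklore] -/
def phiVec (a : Expo) : Fin 4 → ℂ := ![coeff a (u 0), coeff a (u 1), coeff a (v 0), coeff a (v 1)]

/-- The dual main-term vectors `ψ b = (u₁[b], u₀[b], −v₁[b], −v₀[b])`. [folklore] -/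
def psiVec (b : Expo) : Fin 4 → ℂ := ![coeff b (u 1), coeff b (u 0), -coeff b (v 1), -coeff b (v 0)]

/-- `⟨φ a, ψ b⟩ = q(a,b) + q(b,a)`, `q(a,b) = u₀[a]u₁[b] − v₀[a]v₁[b]`. [folklore] -/
theorem phiVec_dotProduct_psiVec (a b : Expo) :
    phiVec u v a ⬝ᵥ psiVec u v b =
      (coeff a (u 0) * coeff b (u 1) - coeff a (v 0) * coeff b (v 1)) +
      (coeff b (u 0) * coeff a (u 1) - coeff b (v 0) * coeff a (v 1)) := by
  simp [phiVec, psiVec, dotProduct, Fin.sum_univ_four]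
  ring

/-- **Coefficient formula off the tail support under unique representation.**  If `a + b ∉ E` and `(a, b)`, `(b, a)` are the
only representations of `a + b` in `E + E`, then the coefficient of `a + b` in `(1+u₀)(1+u₁) − (1+v₀)(1+v₁)` is the main term
`q(a,b) + q(b,a)` for `a ≠ b`, and `q(a,a)` for `a = b`. [folklore] -/
theorem coeff_tailDiff_add (a b : Expo) (hab : a + b ∉ tailSupport u v)
    (huniq : ∀ c ∈ tailSupport u v, ∀ d ∈ tailSupport u v, c + d = a + b → (c = a ∧ d = b) ∨ (c = b ∧ d = a)) :
    coeff (a + b) (tailDiff u v) =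
      (coeff a (u 0) * coeff b (u 1) - coeff a (v 0) * coeff b (v 1)) +
      (if a = b then 0 else (coeff b (u 0) * coeff a (u 1) - coeff b (v 0) * coeff a (v 1))) := by
  classical
  have hT : ∀ (w : Fin 2 → MvPolynomial (Fin 2) ℂ) (j : Fin 2), (w = u ∨ w = v) →
      (w j).support ⊆ tailSupport u v := by
    rintro w j (rfl | rfl) e he
    · exact Finset.mem_union_left _ (Finset.mem_biUnion.2 ⟨j, Finset.mem_univ _, he⟩)
    · exact Finset.mem_union_right _ (Finset.mem_biUnion.2 ⟨j, Finset.mem_univ _, he⟩)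
  have hzero : ∀ (w : Fin 2 → MvPolynomial (Fin 2) ℂ) (j : Fin 2), (w = u ∨ w = v) → coeff (a + b) (w j) = 0 := by
    intro w j hw
    by_contra h
    exact hab (hT w j hw (mem_support_iff.2 h))
  -- the product coefficients
  have hprod : ∀ (w : Fin 2 → MvPolynomial (Fin 2) ℂ), (w = u ∨ w = v) →
      coeff (a + b) (w 0 * w 1) = coeff a (w 0) * coeff b (w 1) +
        (if a = b then 0 else coeff b (w 0) * coeff a (w 1)) := by
    intro w hw
    rw [coeff_mul]
    rw [← Finset.sum_subset (s₁ := ({(a, b), (b, a)} : Finset (Expo × Expo))) ?hsub ?hvan]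
    · by_cases h : a = b
      · subst h
        simp
      · have hne : (a, b) ≠ (b, a) := fun heq => h (Prod.mk.inj heq).1
        rw [Finset.sum_pair hne, if_neg h]
    case hsub =>
      intro x hx
      rw [Finset.HasAntidiagonal.mem_antidiagonal]
      rcases Finset.mem_insert.1 hx with rfl | hx
      · rfl
      · rw [Finset.mem_singleton.1 hx, add_comm]
    case hvan =>
      intro x hx hx'
      by_contra hne
      have h0 : coeff x.1 (w 0) ≠ 0 := left_ne_zero_of_mul hne
      have h1 : coeff x.2 (w 1) ≠ 0 := right_ne_zero_of_mul hne
      have hx1 : x.1 ∈ tailSupport u v := hT w 0 hw (mem_support_iff.2 h0)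
      have hx2 : x.2 ∈ tailSupport u v := hT w 1 hw (mem_support_iff.2 h1)
      have hsum : x.1 + x.2 = a + b := Finset.HasAntidiagonal.mem_antidiagonal.1 hx
      rcases huniq x.1 hx1 x.2 hx2 hsum with ⟨e1, e2⟩ | ⟨e1, e2⟩
      · exact hx' (by rw [show x = (a, b) from Prod.ext e1 e2]; simp)
      · exact hx' (by rw [show x = (b, a) from Prod.ext e1 e2]; simp)
  have hexp : tailDiff u v = (u 0 + u 1 + u 0 * u 1) - (v 0 + v 1 + v 0 * v 1) := by
    unfold tailDiff
    simp only [Fin.prod_univ_two]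
    ring
  rw [hexp, coeff_sub, coeff_add, coeff_add, coeff_add, coeff_add, hzero u 0 (Or.inl rfl), hzero u 1 (Or.inl rfl),
    hzero v 0 (Or.inr rfl), hzero v 1 (Or.inr rfl), hprod u (Or.inl rfl), hprod v (Or.inr rfl)]
  split_ifs <;> ring

/-- Under unique representation, the coefficient at `a + b ∉ E` vanishes iff the main-term pairing `⟨φ a, ψ b⟩` does.
[folklore] -/
theorem coeff_tailDiff_add_eq_zero_iff (a b : Expo) (hab : a + b ∉ tailSupport u v)
    (huniq : ∀ c ∈ tailSupport u v, ∀ d ∈ tailSupport u v, c + d = a + b → (c = a ∧ d = b) ∨ (c = b ∧ d = a)) :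
    coeff (a + b) (tailDiff u v) = 0 ↔ phiVec u v a ⬝ᵥ psiVec u v b = 0 := by
  rw [coeff_tailDiff_add u v a b hab huniq, phiVec_dotProduct_psiVec]
  by_cases h : a = b
  · subst h
    simp only [if_true, add_zero]
    constructor
    · intro h0; rw [h0]; ring
    · intro h0
      have : (2 : ℂ) * (coeff a (u 0) * coeff a (u 1) - coeff a (v 0) * coeff a (v 1)) = 0 := by
        rw [← h0]; ring
      simpa using this
  · rw [if_neg h]

/-- **`m = 2`, COINCIDENCE-FREE TAIL SUPPORT ⇒ AT MOST 5 VISIBLE POINTS PER CELL (t-free).**  If the tail support `E` of two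
tails against two tails satisfies `E ∩ (E+E) = ∅` and unique representation in `E + E`, then every cell family `S` has
`#S ≤ 5`. [folklore] -/
theorem planarCell_two_coincidenceFree
    (hu : ∀ j, coeff 0 (u j) = 0) (hv : ∀ j, coeff 0 (v j) = 0)
    (hfree : ∀ a ∈ tailSupport u v, ∀ b ∈ tailSupport u v, a + b ∉ tailSupport u v)
    (huniq : ∀ a ∈ tailSupport u v, ∀ b ∈ tailSupport u v, ∀ c ∈ tailSupport u v, ∀ d ∈ tailSupport u v,
      c + d = a + b → (c = a ∧ d = b) ∨ (c = b ∧ d = a))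
    (R : Expo → Expo → Prop) (S : Finset Expo)
    (hS : ∀ l ∈ S, ∃ ξ : Fin 2 → ℝ, ValidWeight u v ξ ∧ IsStrictTop ξ (logSupport u v) l ∧
      ∀ e ∈ tailSupport u v, ∀ e' ∈ tailSupport u v, (R e e' ↔ wt ξ e ≤ wt ξ e')) :
    S.card ≤ 5 := by
  classical
  set T := tailSupport u v with hT
  rcases S.eq_empty_or_nonempty with hS0 | ⟨l₀, hl₀⟩
  · simp [hS0]
  obtain ⟨ζ, -, -, hRζ⟩ := hS l₀ hl₀
  choose! ξ hval htop hRξ using hS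
  have htopW : ∀ l ∈ S, IsStrictTop (ξ l) ↑(tailDiff u v).support l := fun l hl =>
    (stub_logLinearisation 2 u v hu hv (ξ l) (hval l hl) l).2 (htop l hl)
  have hsupp : ∀ l ∈ S, l ∈ (tailDiff u v).support := fun l hl => (htopW l hl).1
  set S₁ := S.filter (fun l => l ∈ T) with hS₁
  set S₂ := S.filter (fun l => l ∉ T) with hS₂
  have hS₁card : S₁.card ≤ 1 := by
    refine Finset.card_le_one.2 fun l hl l' hl' => ?_
    rw [hS₁, Finset.mem_filter] at hl hl'
    exact eq_of_visible_mem_tailSupport u v R hl.2 hl'.2 (htop l hl.1) (htop l' hl'.1) (hRξ l hl.1) (hRξ l' hl'.1)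
  have hS₂S : ∀ l ∈ S₂, l ∈ S := fun l hl => (Finset.mem_filter.1 (hS₂ ▸ hl)).1
  -- sorted decompositions outside `T`
  have hdec : ∀ l ∈ S₂, ∃ p : Expo × Expo, p.1 ∈ T ∧ p.2 ∈ T ∧ l = p.1 + p.2 ∧ wt ζ p.2 ≤ wt ζ p.1 := by
    intro l hl
    rw [hS₂, Finset.mem_filter] at hl
    rcases mem_tailSupport_or_add_of_mem_support_tailDiff u v (hsupp l hl.1) with h | ⟨g, hg, g', hg', rfl⟩
    · exact absurd h hl.2
    · rcases le_total (wt ζ g') (wt ζ g) with hle | hle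
      · exact ⟨(g, g'), hg, hg', rfl, hle⟩
      · exact ⟨(g', g), hg', hg, add_comm g g', hle⟩
  choose! dec hdec1 hdec2 hdecsum _hdecsort using hdec
  have hnest : ∀ l ∈ S₂, ∀ l' ∈ S₂, l ≠ l' →
      (wt ζ (dec l').1 < wt ζ (dec l).1 ∧ wt ζ (dec l).2 < wt ζ (dec l').2) ∨
      (wt ζ (dec l).1 < wt ζ (dec l').1 ∧ wt ζ (dec l').2 < wt ζ (dec l).2) := fun l hl l' hl' hne =>
    nested_of_visible u v R hne (hdec1 l hl) (hdec2 l hl) (hdec1 l' hl') (hdec2 l' hl')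
      (hdecsum l hl) (hdecsum l' hl') (htop l (hS₂S l hl)) (htop l' (hS₂S l' hl')) hRζ
      (hRξ l (hS₂S l hl)) (hRξ l' (hS₂S l' hl'))
  -- strict comparisons transfer from `ζ` to any witness weight
  have tr : ∀ l ∈ S, ∀ a ∈ T, ∀ b ∈ T, wt ζ a < wt ζ b → wt (ξ l) a < wt (ξ l) b := by
    intro l hl a ha b hb hlt
    by_contra hle
    have : wt ζ b ≤ wt ζ a := (hRζ b hb a ha).1 ((hRξ l hl b hb a ha).2 (not_lt.1 hle))
    exact absurd hlt (not_lt.2 this)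
  -- the triangular pairing on the subtype `↥S₂`
  let key : ↥S₂ → ℝ := fun l => wt ζ (dec l.1).1
  let φ : ↥S₂ → (Fin 4 → ℂ) := fun l => phiVec u v (dec l.1).1
  let ψ : ↥S₂ → (Fin 4 → ℂ) := fun l => psiVec u v (dec l.1).2
  have hkey : Function.Injective key := by
    intro l l' h
    by_contra hne
    have hne' : (l : Expo) ≠ l' := fun h' => hne (Subtype.ext h')
    rcases hnest l.1 l.2 l'.1 l'.2 hne' with ⟨h1, -⟩ | ⟨h1, -⟩
    · simp only [key] at h; rw [h] at h1; exact lt_irrefl _ h1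
    · simp only [key] at h; rw [h] at h1; exact lt_irrefl _ h1
  have huniq' : ∀ a ∈ T, ∀ b ∈ T, ∀ c ∈ T, ∀ d ∈ T, c + d = a + b → (c = a ∧ d = b) ∨ (c = b ∧ d = a) := huniq
  have h0 : ∀ x y : ↥S₂, key y < key x → φ x ⬝ᵥ ψ y = 0 := by
    intro x y hlt
    have hx := x.2; have hy := y.2
    -- the point `(dec x).1 + (dec y).2` outweighs `y` for the witness of `y`
    set p := (dec x.1).1 + (dec y.1).2 with hp
    have hpT : p ∉ T := hfree _ (hdec1 x.1 hx) _ (hdec2 y.1 hy)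
    have hwt : wt (ξ y.1) (y : Expo) < wt (ξ y.1) p := by
      have h' := tr y.1 (hS₂S y.1 hy) _ (hdec1 y.1 hy) _ (hdec1 x.1 hx) hlt
      have e : wt (ξ y.1) (y : Expo) = wt (ξ y.1) (dec y.1).1 + wt (ξ y.1) (dec y.1).2 := by
        have := congrArg (wt (ξ y.1)) (hdecsum y.1 hy)
        rw [this, wt_add]
      rw [e, hp, wt_add]
      linarith
    have hcoeff : coeff p (tailDiff u v) = 0 := by
      by_contra hne
      have hmem : p ∈ ((tailDiff u v).support : Set Expo) := mem_support_iff.2 hne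
      have hpy : p ≠ (y : Expo) := fun h => by rw [h] at hwt; exact lt_irrefl _ hwt
      have := (htopW y.1 (hS₂S y.1 hy)).2 p hmem hpy
      exact absurd hwt (not_lt.2 this.le)
    exact (coeff_tailDiff_add_eq_zero_iff u v _ _ hpT (huniq' _ (hdec1 x.1 hx) _ (hdec2 y.1 hy))).1 hcoeff
  have h1 : ∀ x : ↥S₂, φ x ⬝ᵥ ψ x ≠ 0 := by
    intro x hzero
    have hx := x.2
    have hpT : (dec x.1).1 + (dec x.1).2 ∉ T := hfree _ (hdec1 x.1 hx) _ (hdec2 x.1 hx)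
    have hcoeff := (coeff_tailDiff_add_eq_zero_iff u v _ _ hpT (huniq' _ (hdec1 x.1 hx) _ (hdec2 x.1 hx))).2 hzero
    rw [← hdecsum x.1 hx] at hcoeff
    exact (mem_support_iff.1 (hsupp x.1 (hS₂S x.1 hx))) hcoeff
  have hLI : LinearIndependent ℂ φ := linearIndependent_of_triangular key hkey φ ψ h0 h1
  have hcard4 : S₂.card ≤ 4 := by
    have h := hLI.fintype_card_le_finrank
    rw [Module.finrank_fin_fun, Fintype.card_coe] at h
    exact h
  have hsplit : S.card = S₁.card + S₂.card := by
    rw [hS₁, hS₂]; exact (Finset.card_filter_add_card_filter_not _).symm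
  omega

end Summit.ValiantsHypothesis.ValiantsHypothesis.Theorems.NewtonUnitEquations.TwoProducts.PlanarCell

end
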